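/-
Copyright (c) 2026 the pub-hodgecm-mathlib formalisation cell (harness21).  Prover seat hodgecm-mathlib-K2E4-p23 (g2), Track B ∕ K2-LIT, h413 =
`stmt-HodgeConjecture-24833`, ENGINE E1, 5Res campaign, deal (80) «(d) ARCH-UNITARITY FILE 2 + FILE 3» of the dealer K2E1-plan (g6) 2026-09-04T10:34:42Z: FILE 2b-1, the pointwise
`u`-DERIVATIVES of the exponential–logarithmic integrand of ★ `K2E1ArchTorusCoefficientU11Defs` (ED. 2).
-/
import Summits.HodgeConjecture.HodgeConjecture.Theorems.K2E1ArchTorusCoefficientU11Defs   -- ★ p859448∕ED. 2 (this seat): `torusP`, `torusQ`, `archTorusExpIntegrand`, `archTorusCoeff_exp`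
import Mathlib.Analysis.SpecialFunctions.Trigonometric.DerivHyp
import Mathlib.Analysis.SpecialFunctions.Log.Deriv
import Mathlib.Analysis.SpecialFunctions.ExpDeriv
import Mathlib.Analysis.Calculus.Deriv.ZPow
import Mathlib.Analysis.Complex.RealDeriv
import HarnessLib

/-!
# K2·E1 — `K2E1ArchTorusCoefficientDerivativesU11`: THE FIRST AND SECOND `u`-DERIVATIVES OF `E_{s,m}(u,θ) = exp((−s − m∕2) log q_u(θ))·P_u(θ)^m` (logarithmic form)
# (FILE 2b-1 of ARCH-UNITARITY: the integrand-level calculus behind the expansion `Φ_{s,m}(e^u) = 1 + (s² − s − m²∕4)u² + O(u³)`)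

Track B ∕ K2-LIT, crux h413 = `stmt-HodgeConjecture-24833`, route of record `HCCMUnconditional`; cell `hodgecm-mathlib`, squad K2, ENGINE E1.  Prover seat `hodgecm-mathlib-K2E4-p23` (g2);
deal (80) of the dealer K2E1-plan (g6).  THEOREMS ONLY (no `def`, no `instance`, no notation, no named-fact hypothesis, no `sorry`); lane `--supports stmt-HodgeConjecture-24833 --as helper`
(count-neutral).  CLOSES NO SOCKET.

THE CALCULUS.  With `P = cosh u − ζ sinh u` (`ζ = e^{iθ}`), `q = cosh 2u − cos θ sinh 2u = |P|² > 0` (★ ED. 2 of the defs leaf), `c := −s − m∕2` and `E = exp(c·log q)·P^m`: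
`P_u = sinh u − ζ cosh u`, `P_uu = P`; `q_u = 2 sinh 2u − 2 cos θ cosh 2u`, `q_uu = 4q`; the LOGARITHMIC DERIVATIVE `A := c·q_u∕q + m·P_u∕P` gives **`E_u = E·A`** and
**`(E·A)_u = E·(A² + A_u)`**, `A_u = c·(4q·q − q_u²)∕q² + m·(P·P − P_u²)∕P²`.  At `u = 0`: `P = q = 1`, `P_u = −ζ`, `q_u = −2cos θ`, so `A(0,θ) = −2c cos θ − mζ` and
`A_u(0,θ) = 4c sin²θ + m(1 − ζ²)`; FILE 2b-2 integrates: `∫_0^{2π} (A(0,θ)² + A_u(0,θ)) dθ = π(4c² + 4cm + 4c + 2m) = 2π·2(s² − s − m²∕4)`.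
WHAT IS HERE (all pointwise in `θ`, for every real `u`): §1 `hasDerivAt_torusP`, `hasDerivAt_torusP'` (second), `hasDerivAt_torusQ`, `hasDerivAt_torusQ'` (`= 4q`), `hasDerivAt_log_torusQ`;
§2 **`hasDerivAt_archTorusExpIntegrand`** (`E_u = E·A`, `A` written out) and **`hasDerivAt_archTorusExpIntegrand_mul_logDeriv`** (`(E·A)_u = E·(A² + A_u)`); §3 the values at `u = 0`;
§4 joint continuity in `(u, θ)` of `E·A` and `E·(A² + A_u)` (for the dominated-convergence bounds of FILE 2b-2).
HONEST LABEL: HC_CM is proved only modulo the 7 printed citations (2 remaining named inputs: hLiu418 = `stmt-HodgeConjecture-24832`, h413 = `stmt-HodgeConjecture-24833`) until rung 0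
closes; this file asserts no named fact and closes no socket; count-neutral.

## References
* [Knapp1986] A. W. Knapp, *Representation Theory of Semisimple Groups* (1986), VII §1 (spherical functions of `SL₂(ℝ)`, the radial part of the Casimir operator).
* [Bump1997] D. Bump, *Automorphic Forms and Representations* (1997), §2.6 Thm. 2.6.3.
-/

set_option autoImplicit false
-- the mandated namespace repeats the single-problem summit's segment (`HodgeConjecture.HodgeConjecture`)
set_option linter.dupNamespace false

noncomputable section

open Real Complex
open Summit.HodgeConjecture.HodgeConjecture.Cruxes.H413.K2E1ArchTorusCoefficientU11Defs

namespace Summit.HodgeConjecture.HodgeConjecture.Cruxes.H413.K2E1ArchTorusCoefficientDerivativesU11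

/-! ## §1 Derivatives of `P`, `q`, `log q` in `u` -/

/-- `∂_u P_u(θ) = sinh u − e^{iθ} cosh u`. [folklore] -/
theorem hasDerivAt_torusP (u θ : ℝ) :
    HasDerivAt (fun u : ℝ => torusP u θ) (((Real.sinh u : ℝ) : ℂ) - Complex.exp (θ * Complex.I) * ((Real.cosh u : ℝ) : ℂ)) u := by
  have h1 : HasDerivAt (fun u : ℝ => ((Real.cosh u : ℝ) : ℂ)) ((Real.sinh u : ℝ) : ℂ) u := (Real.hasDerivAt_cosh u).ofReal_comp
  have h2 : HasDerivAt (fun u : ℝ => ((Real.sinh u : ℝ) : ℂ)) ((Real.cosh u : ℝ) : ℂ) u := (Real.hasDerivAt_sinh u).ofReal_comp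
  exact (h1.sub (h2.const_mul (Complex.exp (θ * Complex.I)))).congr_of_eventuallyEq
    (Filter.Eventually.of_forall fun y => by simp only [Pi.sub_apply, torusP])

/-- `∂_u (sinh u − e^{iθ} cosh u) = P_u(θ)` (`P_uu = P`). [folklore] -/
theorem hasDerivAt_torusP' (u θ : ℝ) :
    HasDerivAt (fun u : ℝ => ((Real.sinh u : ℝ) : ℂ) - Complex.exp (θ * Complex.I) * ((Real.cosh u : ℝ) : ℂ)) (torusP u θ) u := by
  have h1 : HasDerivAt (fun u : ℝ => ((Real.cosh u : ℝ) : ℂ)) ((Real.sinh u : ℝ) : ℂ) u := (Real.hasDerivAt_cosh u).ofReal_comp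
  have h2 : HasDerivAt (fun u : ℝ => ((Real.sinh u : ℝ) : ℂ)) ((Real.cosh u : ℝ) : ℂ) u := (Real.hasDerivAt_sinh u).ofReal_comp
  refine ((h2.sub (h1.const_mul (Complex.exp (θ * Complex.I)))).congr_of_eventuallyEq
    (Filter.Eventually.of_forall fun y => by simp only [Pi.sub_apply])).congr_deriv ?_
  rw [torusP]

/-- `∂_u q_u(θ) = 2 sinh 2u − cos θ·(2 cosh 2u)`. [folklore] -/
theorem hasDerivAt_torusQ (u θ : ℝ) :
    HasDerivAt (fun u : ℝ => torusQ u θ) (2 * Real.sinh (2 * u) - Real.cos θ * (2 * Real.cosh (2 * u))) u := by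
  have h2 : HasDerivAt (fun u : ℝ => 2 * u) 2 u := by simpa using (hasDerivAt_id u).const_mul (2 : ℝ)
  have hc : HasDerivAt (fun u : ℝ => Real.cosh (2 * u)) (Real.sinh (2 * u) * 2) u := (Real.hasDerivAt_cosh (2 * u)).comp u h2
  have hs : HasDerivAt (fun u : ℝ => Real.sinh (2 * u)) (Real.cosh (2 * u) * 2) u := (Real.hasDerivAt_sinh (2 * u)).comp u h2
  have h := hc.sub (hs.const_mul (Real.cos θ))
  have e : Real.sinh (2 * u) * 2 - Real.cos θ * (Real.cosh (2 * u) * 2) = 2 * Real.sinh (2 * u) - Real.cos θ * (2 * Real.cosh (2 * u)) := by ring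
  rw [← e]
  exact h.congr_of_eventuallyEq (Filter.Eventually.of_forall fun v => rfl)

/-- `∂_u (2 sinh 2u − cos θ·2 cosh 2u) = 4 q_u(θ)` (`q_uu = 4q`). [folklore] -/
theorem hasDerivAt_torusQ' (u θ : ℝ) :
    HasDerivAt (fun u : ℝ => 2 * Real.sinh (2 * u) - Real.cos θ * (2 * Real.cosh (2 * u))) (4 * torusQ u θ) u := by
  have h2 : HasDerivAt (fun u : ℝ => 2 * u) 2 u := by simpa using (hasDerivAt_id u).const_mul (2 : ℝ)
  have hc : HasDerivAt (fun u : ℝ => Real.cosh (2 * u)) (Real.sinh (2 * u) * 2) u := (Real.hasDerivAt_cosh (2 * u)).comp u h2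
  have hs : HasDerivAt (fun u : ℝ => Real.sinh (2 * u)) (Real.cosh (2 * u) * 2) u := (Real.hasDerivAt_sinh (2 * u)).comp u h2
  have h := (hs.const_mul (2 : ℝ)).sub ((hc.const_mul (2 : ℝ)).const_mul (Real.cos θ))
  have e : 2 * (Real.cosh (2 * u) * 2) - Real.cos θ * (2 * (Real.sinh (2 * u) * 2)) = 4 * torusQ u θ := by rw [torusQ_def]; ring
  rw [← e]
  exact h

/-- `∂_u log q_u(θ) = q_u(θ)⁻¹·∂_u q_u(θ)` (as a complex-valued function, `q > 0`). [folklore] -/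
theorem hasDerivAt_log_torusQ (u θ : ℝ) :
    HasDerivAt (fun u : ℝ => ((Real.log (torusQ u θ) : ℝ) : ℂ))
      ((((torusQ u θ)⁻¹ * (2 * Real.sinh (2 * u) - Real.cos θ * (2 * Real.cosh (2 * u))) : ℝ) : ℂ)) u := by
  have h := ((Real.hasDerivAt_log (torusQ_pos u θ).ne').comp u (hasDerivAt_torusQ u θ)).ofReal_comp
  exact h

/-! ## §2 `E_u = E·A` and `(E·A)_u = E·(A² + A_u)` -/

/-- **FIRST DERIVATIVE, LOGARITHMIC FORM**: `∂_u E_{s,m}(u,θ) = E_{s,m}(u,θ)·A(u,θ)` with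
`A = (−s − m∕2)·(q⁻¹ q_u) + m·(P_u∕P)` (written out). [cite: Knapp1986, VII §1] -/
theorem hasDerivAt_archTorusExpIntegrand (s : ℂ) (m : ℤ) (u θ : ℝ) :
    HasDerivAt (fun u : ℝ => archTorusExpIntegrand s m u θ)
      (archTorusExpIntegrand s m u θ *
        ((-s - (m : ℂ) / 2) * ((((torusQ u θ)⁻¹ * (2 * Real.sinh (2 * u) - Real.cos θ * (2 * Real.cosh (2 * u))) : ℝ) : ℂ)) +
          (m : ℂ) * ((((Real.sinh u : ℝ) : ℂ) - Complex.exp (θ * Complex.I) * ((Real.cosh u : ℝ) : ℂ)) / torusP u θ))) u := by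
  have hP : torusP u θ ≠ 0 := torusP_ne_zero u θ
  -- the exponential factor
  have hexp : HasDerivAt (fun u : ℝ => Complex.exp ((-s - (m : ℂ) / 2) * ((Real.log (torusQ u θ) : ℝ) : ℂ)))
      (Complex.exp ((-s - (m : ℂ) / 2) * ((Real.log (torusQ u θ) : ℝ) : ℂ)) *
        ((-s - (m : ℂ) / 2) * ((((torusQ u θ)⁻¹ * (2 * Real.sinh (2 * u) - Real.cos θ * (2 * Real.cosh (2 * u))) : ℝ) : ℂ)))) u :=
    ((hasDerivAt_log_torusQ u θ).const_mul (-s - (m : ℂ) / 2)).cexp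
  -- the power factor
  have hpow : HasDerivAt (fun u : ℝ => torusP u θ ^ m)
      ((m : ℂ) * torusP u θ ^ (m - 1) * (((Real.sinh u : ℝ) : ℂ) - Complex.exp (θ * Complex.I) * ((Real.cosh u : ℝ) : ℂ))) u := by
    have h := (hasDerivAt_zpow m (torusP u θ) (Or.inl hP)).comp u (hasDerivAt_torusP u θ)
    exact h.congr_of_eventuallyEq (Filter.Eventually.of_forall fun y => rfl)
  refine ((hexp.mul hpow).congr_of_eventuallyEq (Filter.Eventually.of_forall fun y => ?_)).congr_deriv ?_
  · simp only [Pi.mul_apply, archTorusExpIntegrand_def]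
  · rw [archTorusExpIntegrand_def, zpow_sub_one₀ hP, div_eq_mul_inv]
    ring

/-- **SECOND DERIVATIVE, LOGARITHMIC FORM** (product-rule shape): `∂_u (E·A) = (E·A)·A + E·A_u` with
`A_u = (−s − m∕2)·((4q·q − q_u·q_u)∕q²) + m·((P·P − P_u·P_u)∕P²)` (written out; `q_uu = 4q`, `P_uu = P`). [cite: Knapp1986, VII §1] -/
theorem hasDerivAt_archTorusExpIntegrand_mul_logDeriv (s : ℂ) (m : ℤ) (u θ : ℝ) :
    HasDerivAt (fun u : ℝ => archTorusExpIntegrand s m u θ *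
        ((-s - (m : ℂ) / 2) * ((((torusQ u θ)⁻¹ * (2 * Real.sinh (2 * u) - Real.cos θ * (2 * Real.cosh (2 * u))) : ℝ) : ℂ)) +
          (m : ℂ) * ((((Real.sinh u : ℝ) : ℂ) - Complex.exp (θ * Complex.I) * ((Real.cosh u : ℝ) : ℂ)) / torusP u θ)))
      (archTorusExpIntegrand s m u θ *
        ((-s - (m : ℂ) / 2) * ((((torusQ u θ)⁻¹ * (2 * Real.sinh (2 * u) - Real.cos θ * (2 * Real.cosh (2 * u))) : ℝ) : ℂ)) +
          (m : ℂ) * ((((Real.sinh u : ℝ) : ℂ) - Complex.exp (θ * Complex.I) * ((Real.cosh u : ℝ) : ℂ)) / torusP u θ)) *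
        ((-s - (m : ℂ) / 2) * ((((torusQ u θ)⁻¹ * (2 * Real.sinh (2 * u) - Real.cos θ * (2 * Real.cosh (2 * u))) : ℝ) : ℂ)) +
          (m : ℂ) * ((((Real.sinh u : ℝ) : ℂ) - Complex.exp (θ * Complex.I) * ((Real.cosh u : ℝ) : ℂ)) / torusP u θ)) +
        archTorusExpIntegrand s m u θ *
        ((-s - (m : ℂ) / 2) * (((((4 * torusQ u θ) * torusQ u θ -
              (2 * Real.sinh (2 * u) - Real.cos θ * (2 * Real.cosh (2 * u))) * (2 * Real.sinh (2 * u) - Real.cos θ * (2 * Real.cosh (2 * u)))) /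
              (torusQ u θ) ^ 2 : ℝ)) : ℂ) +
          (m : ℂ) * ((torusP u θ * torusP u θ -
              (((Real.sinh u : ℝ) : ℂ) - Complex.exp (θ * Complex.I) * ((Real.cosh u : ℝ) : ℂ)) *
                (((Real.sinh u : ℝ) : ℂ) - Complex.exp (θ * Complex.I) * ((Real.cosh u : ℝ) : ℂ))) / (torusP u θ) ^ 2))) u := by
  have hP : torusP u θ ≠ 0 := torusP_ne_zero u θ
  have hq : torusQ u θ ≠ 0 := (torusQ_pos u θ).ne'
  -- `A_u`: the real quotient `q_u ∕ q` and the complex quotient `P_u ∕ P`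
  have hquot_q : HasDerivAt (fun u : ℝ => (torusQ u θ)⁻¹ * (2 * Real.sinh (2 * u) - Real.cos θ * (2 * Real.cosh (2 * u))))
      (((4 * torusQ u θ) * torusQ u θ -
          (2 * Real.sinh (2 * u) - Real.cos θ * (2 * Real.cosh (2 * u))) * (2 * Real.sinh (2 * u) - Real.cos θ * (2 * Real.cosh (2 * u)))) /
        (torusQ u θ) ^ 2) u := by
    have h := (hasDerivAt_torusQ' u θ).div (hasDerivAt_torusQ u θ) hq
    refine (h.congr_of_eventuallyEq (Filter.Eventually.of_forall fun v => ?_))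
    show (torusQ v θ)⁻¹ * _ = _ / torusQ v θ
    rw [inv_mul_eq_div]
  have hquot_qC : HasDerivAt (fun u : ℝ => (((torusQ u θ)⁻¹ * (2 * Real.sinh (2 * u) - Real.cos θ * (2 * Real.cosh (2 * u))) : ℝ) : ℂ))
      (((((4 * torusQ u θ) * torusQ u θ -
          (2 * Real.sinh (2 * u) - Real.cos θ * (2 * Real.cosh (2 * u))) * (2 * Real.sinh (2 * u) - Real.cos θ * (2 * Real.cosh (2 * u)))) /
        (torusQ u θ) ^ 2 : ℝ)) : ℂ) u := hquot_q.ofReal_comp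
  have hquot_P : HasDerivAt (fun u : ℝ => (((Real.sinh u : ℝ) : ℂ) - Complex.exp (θ * Complex.I) * ((Real.cosh u : ℝ) : ℂ)) / torusP u θ)
      ((torusP u θ * torusP u θ -
          (((Real.sinh u : ℝ) : ℂ) - Complex.exp (θ * Complex.I) * ((Real.cosh u : ℝ) : ℂ)) *
            (((Real.sinh u : ℝ) : ℂ) - Complex.exp (θ * Complex.I) * ((Real.cosh u : ℝ) : ℂ))) / (torusP u θ) ^ 2) u :=
    (hasDerivAt_torusP' u θ).div (hasDerivAt_torusP u θ) hP
  have hA := (hquot_qC.const_mul (-s - (m : ℂ) / 2)).add (hquot_P.const_mul (m : ℂ))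
  have hE := hasDerivAt_archTorusExpIntegrand s m u θ
  exact (hE.mul hA).congr_of_eventuallyEq (Filter.Eventually.of_forall fun y => rfl)

/-! ## §3 Values at `u = 0` -/

/-- `A(0, θ) = (−s − m∕2)·(−2 cos θ) + m·(−e^{iθ})`. [folklore] -/
theorem logDeriv_zero (s : ℂ) (m : ℤ) (θ : ℝ) :
    (-s - (m : ℂ) / 2) * ((((torusQ 0 θ)⁻¹ * (2 * Real.sinh (2 * 0) - Real.cos θ * (2 * Real.cosh (2 * 0))) : ℝ) : ℂ)) +
        (m : ℂ) * ((((Real.sinh 0 : ℝ) : ℂ) - Complex.exp (θ * Complex.I) * ((Real.cosh 0 : ℝ) : ℂ)) / torusP 0 θ) =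
      (-s - (m : ℂ) / 2) * (-2 * (Real.cos θ : ℂ)) + (m : ℂ) * (-Complex.exp (θ * Complex.I)) := by
  rw [torusQ_zero, torusP_zero, mul_zero, Real.sinh_zero, Real.cosh_zero, inv_one, one_mul, div_one]
  push_cast
  ring

/-- `A_u(0, θ) = (−s − m∕2)·(4 − 4cos²θ) + m·(1 − e^{2iθ})` (with `e^{2iθ}` written as `e^{iθ}·e^{iθ}`). [folklore] -/
theorem logDeriv_deriv_zero (s : ℂ) (m : ℤ) (θ : ℝ) :
    (-s - (m : ℂ) / 2) * (((((4 * torusQ 0 θ) * torusQ 0 θ -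
          (2 * Real.sinh (2 * 0) - Real.cos θ * (2 * Real.cosh (2 * 0))) * (2 * Real.sinh (2 * 0) - Real.cos θ * (2 * Real.cosh (2 * 0)))) /
          (torusQ 0 θ) ^ 2 : ℝ)) : ℂ) +
        (m : ℂ) * ((torusP 0 θ * torusP 0 θ -
          (((Real.sinh 0 : ℝ) : ℂ) - Complex.exp (θ * Complex.I) * ((Real.cosh 0 : ℝ) : ℂ)) *
            (((Real.sinh 0 : ℝ) : ℂ) - Complex.exp (θ * Complex.I) * ((Real.cosh 0 : ℝ) : ℂ))) / (torusP 0 θ) ^ 2) =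
      (-s - (m : ℂ) / 2) * (4 - 4 * (Real.cos θ : ℂ) ^ 2) + (m : ℂ) * (1 - Complex.exp (θ * Complex.I) * Complex.exp (θ * Complex.I)) := by
  rw [torusQ_zero, torusP_zero, mul_zero, Real.sinh_zero, Real.cosh_zero]
  push_cast
  ring

/-! ## §4 Joint continuity in `(u, θ)` (for the dominated-convergence bounds) -/

/-- `(u,θ) ↦ E_{s,m}(u,θ)` is continuous. [folklore] -/
theorem continuous_archTorusExpIntegrand₂ (s : ℂ) (m : ℤ) : Continuous fun p : ℝ × ℝ => archTorusExpIntegrand s m p.1 p.2 := by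
  have hlog : Continuous fun p : ℝ × ℝ => Real.log (torusQ p.1 p.2) :=
    continuous_torusQ₂.log fun p => (torusQ_pos p.1 p.2).ne'
  have h1 : Continuous fun p : ℝ × ℝ => Complex.exp ((-s - (m : ℂ) / 2) * ((Real.log (torusQ p.1 p.2) : ℝ) : ℂ)) :=
    Complex.continuous_exp.comp (continuous_const.mul (Complex.continuous_ofReal.comp hlog))
  have h2 : Continuous fun p : ℝ × ℝ => torusP p.1 p.2 ^ m :=
    continuous_torusP₂.zpow₀ m fun p => Or.inl (torusP_ne_zero p.1 p.2)
  exact (h1.mul h2).congr fun p => rfl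

/-- `(u,θ) ↦ q_u(θ)⁻¹·∂_u q_u(θ)` is continuous. [folklore] -/
theorem continuous_logDerivQ₂ :
    Continuous fun p : ℝ × ℝ => (torusQ p.1 p.2)⁻¹ * (2 * Real.sinh (2 * p.1) - Real.cos p.2 * (2 * Real.cosh (2 * p.1))) := by
  refine (continuous_torusQ₂.inv₀ fun p => (torusQ_pos p.1 p.2).ne').mul ?_
  fun_prop

/-- `(u,θ) ↦ P_u(θ)∕P` ... precisely `(sinh u − e^{iθ} cosh u)∕P_u(θ)` is continuous. [folklore] -/
theorem continuous_logDerivP₂ :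
    Continuous fun p : ℝ × ℝ => (((Real.sinh p.1 : ℝ) : ℂ) - Complex.exp (p.2 * Complex.I) * ((Real.cosh p.1 : ℝ) : ℂ)) / torusP p.1 p.2 := by
  refine Continuous.div ?_ continuous_torusP₂ fun p => torusP_ne_zero p.1 p.2
  fun_prop

/-- `(u,θ) ↦ A(u,θ)` is continuous. [folklore] -/
theorem continuous_logDeriv₂ (s : ℂ) (m : ℤ) :
    Continuous fun p : ℝ × ℝ =>
      (-s - (m : ℂ) / 2) * ((((torusQ p.1 p.2)⁻¹ * (2 * Real.sinh (2 * p.1) - Real.cos p.2 * (2 * Real.cosh (2 * p.1))) : ℝ) : ℂ)) +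
        (m : ℂ) * ((((Real.sinh p.1 : ℝ) : ℂ) - Complex.exp (p.2 * Complex.I) * ((Real.cosh p.1 : ℝ) : ℂ)) / torusP p.1 p.2) :=
  (continuous_const.mul (Complex.continuous_ofReal.comp continuous_logDerivQ₂)).add (continuous_const.mul continuous_logDerivP₂)

/-- `(u,θ) ↦ A_u(u,θ)` is continuous. [folklore] -/
theorem continuous_logDeriv_deriv₂ (s : ℂ) (m : ℤ) :
    Continuous fun p : ℝ × ℝ =>
      (-s - (m : ℂ) / 2) * (((((4 * torusQ p.1 p.2) * torusQ p.1 p.2 -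
            (2 * Real.sinh (2 * p.1) - Real.cos p.2 * (2 * Real.cosh (2 * p.1))) * (2 * Real.sinh (2 * p.1) - Real.cos p.2 * (2 * Real.cosh (2 * p.1)))) /
            (torusQ p.1 p.2) ^ 2 : ℝ)) : ℂ) +
        (m : ℂ) * ((torusP p.1 p.2 * torusP p.1 p.2 -
            (((Real.sinh p.1 : ℝ) : ℂ) - Complex.exp (p.2 * Complex.I) * ((Real.cosh p.1 : ℝ) : ℂ)) *
              (((Real.sinh p.1 : ℝ) : ℂ) - Complex.exp (p.2 * Complex.I) * ((Real.cosh p.1 : ℝ) : ℂ))) / (torusP p.1 p.2) ^ 2) := by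
  have hq : Continuous fun p : ℝ × ℝ => ((4 * torusQ p.1 p.2) * torusQ p.1 p.2 -
      (2 * Real.sinh (2 * p.1) - Real.cos p.2 * (2 * Real.cosh (2 * p.1))) * (2 * Real.sinh (2 * p.1) - Real.cos p.2 * (2 * Real.cosh (2 * p.1)))) /
      (torusQ p.1 p.2) ^ 2 := by
    refine Continuous.div ?_ (continuous_torusQ₂.pow 2) fun p => pow_ne_zero 2 (torusQ_pos p.1 p.2).ne'
    have := continuous_torusQ₂
    fun_prop
  have hP : Continuous fun p : ℝ × ℝ => (torusP p.1 p.2 * torusP p.1 p.2 -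
      (((Real.sinh p.1 : ℝ) : ℂ) - Complex.exp (p.2 * Complex.I) * ((Real.cosh p.1 : ℝ) : ℂ)) *
        (((Real.sinh p.1 : ℝ) : ℂ) - Complex.exp (p.2 * Complex.I) * ((Real.cosh p.1 : ℝ) : ℂ))) / (torusP p.1 p.2) ^ 2 := by
    refine Continuous.div ?_ (continuous_torusP₂.pow 2) fun p => pow_ne_zero 2 (torusP_ne_zero p.1 p.2)
    have := continuous_torusP₂
    fun_prop
  exact (continuous_const.mul (Complex.continuous_ofReal.comp hq)).add (continuous_const.mul hP)

end Summit.HodgeConjecture.HodgeConjecture.Cruxes.H413.K2E1ArchTorusCoefficientDerivativesU11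

end
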